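import Literature.AnabelianGeometry.SemiGraphs.TemperedCor39cDischargeAt
import Literature.AnabelianGeometry.SemiGraphs.TemperedReconstructionR0CompatProofsAt
import Literature.AnabelianGeometry.SemiGraphs.TemperedCompactInVerticialFinite
import HarnessLib

/-!
# [SemiAnbd] Cor 3.9 ↔ Thm 5.4 junction at FINITE graphs: the shadows dictionary, hypothesis-free

Mochizuki, *Semi-graphs of anabelioids*, Publ. RIMS **42** (2006), §3, Corollary 3.9 pp. 42–43, with
Theorem 3.7 (iii)/(iv) p. 41 ("Since the semi-graphs `𝔾_j` are all finite")
[cite: MochizukiSemiAnbd2006, Cor 3.9 pp.42-43].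

PROOF-ONLY one-screen corollaries (cell abc-iut, layer L3, L3-lead ruling α52 (1) «finite-graph
one-screeners of the w4-d080 lineage»; seat abc-iut-w4-d080; no definition).  abc-iut-L3-t8's
`compactInVerticialAt_of_finiteGraph` (`TemperedCompactInVerticialFinite.lean`: [SemiAnbd] Thm 3.7 (iii) at
every FINITE graph from `Thm37Hypotheses` alone) and `maximalCompactIffVerticialAt_of_finiteGraph` discharge
the Thm 3.7 (iii)/(iv)-At binders of the w4-d080 lineage's per-pair Cor 3.9 ↔ Thm 5.4 junction files
(`TemperedReconstructionR0CompatProofsAt`, `TemperedCor39cDischargeAt`), so that at a pair `𝒢`, `ℋ` of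
FINITE graphs of anabelioids under the hypotheses of Cor. 3.9 the following hold with NO Thm-3.7 binder:

* `isCompatiblyQuasiGeometric_of_compatAt_of_finite` — (R0′) a continuous `φ` compatible (CompatV/CompatE)
  with a locally open `F : 𝒢 → ℋ` is compatibly quasi-geometric;
* `exists_hom_chartPullbackWith_iso_of_shadowsAt_of_finite` (and the primed shape `…'_of_finite`) — the
  chart-level shadows (hV), (hE), (hC) of `φ` ⇒ `φ` is induced up to twist by a locally open `F`;
* `exists_hom_compat_unique_of_shadowsAt_of_finite` — the full junction package (induced up to twist +
  Prop 3.6 (iv) compatibility + uniqueness of the base morphism);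
* `shadows_of_exists_chartPullbackWith_isoAt_of_finite` — conversely, an induced `φ` has the shadows.

Print covers exactly this finite case; for infinite countable graphs the binders stay (GAP G-t6g3-2b).
Nothing here bears on [IUTchIII] Cor. 3.12.
-/

namespace Literature.AnabelianGeometry.SemiGraphs

namespace ProfiniteSemiGraph

open CategoryTheory Topology

universe u

variable {𝒢 ℋ : ProfiniteSemiGraph.{u}}

/-- **(R0′) at finite graphs**: a continuous homomorphism of tempered fundamental groups compatible with a
locally open `F : 𝒢 → ℋ` on verticial (CompatV) and edge (CompatE) homomorphisms is compatibly
quasi-geometric — `isCompatiblyQuasiGeometric_of_compatAt` with Thm 3.7 (i)/(ii) by name and (iii)/(iv)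
at both finite graphs by abc-iut-L3-t8's `…_of_finiteGraph`. [cite: MochizukiSemiAnbd2006, Cor 3.9 pp.42-43] -/
theorem isCompatiblyQuasiGeometric_of_compatAt_of_finite [Finite 𝒢.graph.Vertex] [Finite 𝒢.graph.Edge]
    [Finite ℋ.graph.Vertex] [Finite ℋ.graph.Edge] (h𝒢 : Cor39Hypotheses 𝒢) (hℋ : Cor39Hypotheses ℋ)
    (c𝒢 : TemperedPiChart 𝒢) (cℋ : TemperedPiChart ℋ) (F : Hom 𝒢 ℋ) (φ : c𝒢.G →ₜ* cℋ.G)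
    (hF : F.IsLocallyOpen) (hV : F.CompatV c𝒢 cℋ φ) (hE : F.CompatE c𝒢 cℋ φ) :
    IsCompatiblyQuasiGeometric φ :=
  isCompatiblyQuasiGeometric_of_compatAt verticialInjective_holds verticialDistinct_holds
    compactInVerticialAt_of_finiteGraph maximalCompactIffVerticialAt_of_finiteGraph
    maximalCompactIffVerticialAt_of_finiteGraph h𝒢 hℋ c𝒢 cℋ F φ hF hV hE

/-- **Shadows ⇒ induced up to twist, at finite graphs** (Cor 3.9 (b) through the chart-level shadows (hV),
(hE), (hC); the Thm 3.7 (iii)-At binders of `exists_hom_chartPullbackWith_iso_of_shadowsAt` discharged by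
abc-iut-L3-t8's finite-graph theorem). [cite: MochizukiSemiAnbd2006, Cor 3.9 pp.42-43] -/
theorem exists_hom_chartPullbackWith_iso_of_shadowsAt_of_finite [Finite 𝒢.graph.Vertex]
    [Finite 𝒢.graph.Edge] [Finite ℋ.graph.Vertex] [Finite ℋ.graph.Edge]
    (h𝒢 : Cor39Hypotheses 𝒢) (hℋ : Cor39Hypotheses ℋ)
    (c𝒢 : TemperedPiChart 𝒢) (cℋ : TemperedPiChart ℋ) (φ : c𝒢.G →ₜ* cℋ.G)
    (hV : ∀ (v : 𝒢.graph.Vertex) (K : Subgroup c𝒢.G), K ∈ verticialSubgroups c𝒢 v →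
      ∃ (w : ℋ.graph.Vertex) (K₂ : Subgroup cℋ.G), K₂ ∈ verticialSubgroups cℋ w ∧
        MapsOntoOpenSubgroupOf φ.toMonoidHom K K₂)
    (hE : ∀ (e : 𝒢.graph.Edge) (L : Subgroup c𝒢.G), 𝒢.graph.IsClosedEdge e →
      L ∈ edgeLikeSubgroups c𝒢 e → L ≠ ⊥ →
      ∃ (e' : ℋ.graph.Edge) (L₂ : Subgroup cℋ.G), ℋ.graph.IsClosedEdge e' ∧
        L₂ ∈ edgeLikeSubgroups cℋ e' ∧ L₂ ≠ ⊥ ∧ MapsOntoOpenSubgroupOf φ.toMonoidHom L L₂)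
    (hC : ∀ (v₁ v₂ : 𝒢.graph.Vertex) (K₁ H₁ : Subgroup c𝒢.G), K₁ ∈ verticialSubgroups c𝒢 v₁ →
      H₁ ∈ verticialSubgroups c𝒢 v₂ → K₁ ≠ H₁ → K₁ ⊓ H₁ ≠ ⊥ →
      ∃ (w₁ w₂ : ℋ.graph.Vertex) (K₂ H₂ : Subgroup cℋ.G), K₂ ∈ verticialSubgroups cℋ w₁ ∧
        H₂ ∈ verticialSubgroups cℋ w₂ ∧ K₂ ≠ H₂ ∧ K₁.map φ.toMonoidHom ≤ K₂ ∧ H₁.map φ.toMonoidHom ≤ H₂) :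
    ∃ F : Hom 𝒢 ℋ, F.IsLocallyOpen ∧
      ∃ θ : F.ConjugatorFamily, Nonempty (F.chartPullbackWith θ c𝒢 cℋ ≅ BTemp.res φ) :=
  exists_hom_chartPullbackWith_iso_of_shadowsAt compactInVerticialAt_of_finiteGraph
    compactInVerticialAt_of_finiteGraph h𝒢 hℋ c𝒢 cℋ φ hV hE hC

/-- The same in the PRIMED shape of the second antecedent (no `L₂ ≠ ⊥` in the target of (hE)), at finite
graphs. [cite: MochizukiSemiAnbd2006, Cor 3.9 pp.42-43] -/
theorem exists_hom_chartPullbackWith_iso_of_shadowsAt'_of_finite [Finite 𝒢.graph.Vertex]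
    [Finite 𝒢.graph.Edge] [Finite ℋ.graph.Vertex] [Finite ℋ.graph.Edge]
    (h𝒢 : Cor39Hypotheses 𝒢) (hℋ : Cor39Hypotheses ℋ)
    (c𝒢 : TemperedPiChart 𝒢) (cℋ : TemperedPiChart ℋ) (φ : c𝒢.G →ₜ* cℋ.G)
    (hV : ∀ (v : 𝒢.graph.Vertex) (K : Subgroup c𝒢.G), K ∈ verticialSubgroups c𝒢 v →
      ∃ (w : ℋ.graph.Vertex) (K₂ : Subgroup cℋ.G), K₂ ∈ verticialSubgroups cℋ w ∧
        MapsOntoOpenSubgroupOf φ.toMonoidHom K K₂)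
    (hE : ∀ (e : 𝒢.graph.Edge) (L : Subgroup c𝒢.G), 𝒢.graph.IsClosedEdge e →
      L ∈ edgeLikeSubgroups c𝒢 e → L ≠ ⊥ →
      ∃ (e' : ℋ.graph.Edge) (L₂ : Subgroup cℋ.G), ℋ.graph.IsClosedEdge e' ∧
        L₂ ∈ edgeLikeSubgroups cℋ e' ∧ MapsOntoOpenSubgroupOf φ.toMonoidHom L L₂)
    (hC : ∀ (v₁ v₂ : 𝒢.graph.Vertex) (K₁ H₁ : Subgroup c𝒢.G), K₁ ∈ verticialSubgroups c𝒢 v₁ →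
      H₁ ∈ verticialSubgroups c𝒢 v₂ → K₁ ≠ H₁ → K₁ ⊓ H₁ ≠ ⊥ →
      ∃ (w₁ w₂ : ℋ.graph.Vertex) (K₂ H₂ : Subgroup cℋ.G), K₂ ∈ verticialSubgroups cℋ w₁ ∧
        H₂ ∈ verticialSubgroups cℋ w₂ ∧ K₂ ≠ H₂ ∧ K₁.map φ.toMonoidHom ≤ K₂ ∧ H₁.map φ.toMonoidHom ≤ H₂) :
    ∃ F : Hom 𝒢 ℋ, F.IsLocallyOpen ∧
      ∃ θ : F.ConjugatorFamily, Nonempty (F.chartPullbackWith θ c𝒢 cℋ ≅ BTemp.res φ) :=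
  exists_hom_chartPullbackWith_iso_of_shadowsAt' compactInVerticialAt_of_finiteGraph
    compactInVerticialAt_of_finiteGraph h𝒢 hℋ c𝒢 cℋ φ hV hE hC

/-- **The full junction package at finite graphs**: from the shadows (primed shape), a locally open
`F : 𝒢 → ℋ` inducing `φ` up to twist, compatible with `φ` on every verticial and edge homomorphism, and
unique on the underlying semi-graphs among locally open morphisms inducing `φ`.
[cite: MochizukiSemiAnbd2006, Cor 3.9 pp.42-43] -/
theorem exists_hom_compat_unique_of_shadowsAt_of_finite [Finite 𝒢.graph.Vertex]
    [Finite 𝒢.graph.Edge] [Finite ℋ.graph.Vertex] [Finite ℋ.graph.Edge]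
    (h𝒢 : Cor39Hypotheses 𝒢) (hℋ : Cor39Hypotheses ℋ)
    (c𝒢 : TemperedPiChart 𝒢) (cℋ : TemperedPiChart ℋ) (φ : c𝒢.G →ₜ* cℋ.G)
    (hV : ∀ (v : 𝒢.graph.Vertex) (K : Subgroup c𝒢.G), K ∈ verticialSubgroups c𝒢 v →
      ∃ (w : ℋ.graph.Vertex) (K₂ : Subgroup cℋ.G), K₂ ∈ verticialSubgroups cℋ w ∧
        MapsOntoOpenSubgroupOf φ.toMonoidHom K K₂)
    (hE : ∀ (e : 𝒢.graph.Edge) (L : Subgroup c𝒢.G), 𝒢.graph.IsClosedEdge e →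
      L ∈ edgeLikeSubgroups c𝒢 e → L ≠ ⊥ →
      ∃ (e' : ℋ.graph.Edge) (L₂ : Subgroup cℋ.G), ℋ.graph.IsClosedEdge e' ∧
        L₂ ∈ edgeLikeSubgroups cℋ e' ∧ MapsOntoOpenSubgroupOf φ.toMonoidHom L L₂)
    (hC : ∀ (v₁ v₂ : 𝒢.graph.Vertex) (K₁ H₁ : Subgroup c𝒢.G), K₁ ∈ verticialSubgroups c𝒢 v₁ →
      H₁ ∈ verticialSubgroups c𝒢 v₂ → K₁ ≠ H₁ → K₁ ⊓ H₁ ≠ ⊥ →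
      ∃ (w₁ w₂ : ℋ.graph.Vertex) (K₂ H₂ : Subgroup cℋ.G), K₂ ∈ verticialSubgroups cℋ w₁ ∧
        H₂ ∈ verticialSubgroups cℋ w₂ ∧ K₂ ≠ H₂ ∧ K₁.map φ.toMonoidHom ≤ K₂ ∧ H₁.map φ.toMonoidHom ≤ H₂) :
    ∃ F : Hom 𝒢 ℋ, F.IsLocallyOpen ∧
      (∃ θ : F.ConjugatorFamily, Nonempty (F.chartPullbackWith θ c𝒢 cℋ ≅ BTemp.res φ)) ∧
      F.CompatV c𝒢 cℋ φ ∧ F.CompatE c𝒢 cℋ φ ∧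
      ∀ F' : Hom 𝒢 ℋ, F'.IsLocallyOpen →
        (∃ θ' : F'.ConjugatorFamily, Nonempty (F'.chartPullbackWith θ' c𝒢 cℋ ≅ BTemp.res φ)) →
          F'.base = F.base :=
  exists_hom_compat_unique_of_shadowsAt compactInVerticialAt_of_finiteGraph
    compactInVerticialAt_of_finiteGraph h𝒢 hℋ c𝒢 cℋ φ hV hE hC

/-- **The shadows of an induced homomorphism, at finite graphs** (the converse direction of the junction,
hypothesis-free). [cite: MochizukiSemiAnbd2006, Cor 3.9 pp.42-43] -/
theorem shadows_of_exists_chartPullbackWith_isoAt_of_finite [Finite 𝒢.graph.Vertex] [Finite 𝒢.graph.Edge]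
    [Finite ℋ.graph.Vertex] [Finite ℋ.graph.Edge] (h𝒢 : Cor39Hypotheses 𝒢) (hℋ : Cor39Hypotheses ℋ)
    (c𝒢 : TemperedPiChart 𝒢) (cℋ : TemperedPiChart ℋ) (F : Hom 𝒢 ℋ) (φ : c𝒢.G →ₜ* cℋ.G)
    (hF : F.IsLocallyOpen)
    (hind : ∃ θ : F.ConjugatorFamily, Nonempty (F.chartPullbackWith θ c𝒢 cℋ ≅ BTemp.res φ)) :
    (∀ (v : 𝒢.graph.Vertex) (K : Subgroup c𝒢.G), K ∈ verticialSubgroups c𝒢 v →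
      ∃ (w : ℋ.graph.Vertex) (K₂ : Subgroup cℋ.G), K₂ ∈ verticialSubgroups cℋ w ∧
        MapsOntoOpenSubgroupOf φ.toMonoidHom K K₂) ∧
    (∀ (e : 𝒢.graph.Edge) (L : Subgroup c𝒢.G), 𝒢.graph.IsClosedEdge e →
      L ∈ edgeLikeSubgroups c𝒢 e → L ≠ ⊥ →
      ∃ (e' : ℋ.graph.Edge) (L₂ : Subgroup cℋ.G), ℋ.graph.IsClosedEdge e' ∧
        L₂ ∈ edgeLikeSubgroups cℋ e' ∧ L₂ ≠ ⊥ ∧ MapsOntoOpenSubgroupOf φ.toMonoidHom L L₂) ∧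
    (∀ (v₁ v₂ : 𝒢.graph.Vertex) (K₁ H₁ : Subgroup c𝒢.G), K₁ ∈ verticialSubgroups c𝒢 v₁ →
      H₁ ∈ verticialSubgroups c𝒢 v₂ → K₁ ≠ H₁ → K₁ ⊓ H₁ ≠ ⊥ →
      ∃ (w₁ w₂ : ℋ.graph.Vertex) (K₂ H₂ : Subgroup cℋ.G), K₂ ∈ verticialSubgroups cℋ w₁ ∧
        H₂ ∈ verticialSubgroups cℋ w₂ ∧ K₂ ≠ H₂ ∧ K₁.map φ.toMonoidHom ≤ K₂ ∧
        H₁.map φ.toMonoidHom ≤ H₂) :=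
  shadows_of_exists_chartPullbackWith_isoAt compactInVerticialAt_of_finiteGraph
    compactInVerticialAt_of_finiteGraph h𝒢 hℋ c𝒢 cℋ F φ hF hind

end ProfiniteSemiGraph

end Literature.AnabelianGeometry.SemiGraphs
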